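import Summits.HubbardSuperconductivity.HubbardSuperconductivity.Theorems.AnisotropyChordFourTorusWitness
import Summits.HubbardSuperconductivity.HubbardSuperconductivity.Theorems.AnisotropyChordFourTorusClassTable

/-!
# Route `AnisotropyChord` / crux `FerroSideChord` at `M = 4`: KERNEL-EVALUATED symmetry bookkeeping of the `4 × 4` torus, I
(prover seat `hubbard-h0-rotor-p1` g17)

Pure `ℕ` arithmetic on binary literals (kernel-accelerated operations); accumulator-passing `Nat.rec` loops nested so that no
lazily built term is deeper than a few hundred; no `Finset` over configuration types.  Conventions as in `…FourTorusWitness` (tables in the sub-namespace `Tab`).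
* `actCode t k` — action of the symmetry `t < 768` on a code `k < 2^16`; `siteMap p m` / `siteInv p m` — its site permutation;
  `cls k` — class of a weight-8 code (table); `rep8`, `rep9`; `rank k` — colexicographic rank among the codes of equal weight
  (an indexing device only); `wit8 k`, `cls9 k`, `wit9 k` — table entries at `rank k`.
* KERNEL FACTS of this file (each `decide +kernel` under the default budget): `pop16_spec` (the nibble-table bit count is the
  bit count), `siteMap_spec` (`siteMap p m` is a permutation of the 16 sites with inverse `siteInv p m` preserving the
  adjacency table `adj16`), `check8_lo/hi` (every weight-8 code `k` has `cls k < 58`, `wit8 k < 768`,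
  `actCode (wit8 k) (rep8 (cls k)) = k`) and `counts8_eq` live in `…FourTorusKernelEight`, the weight-9 facts in
`…FourTorusKernelNine`, the certificate matrices in `…FourTorusKernelMatrix` / `…FourTorusKernelCert`.
-/

set_option linter.style.longLine false
set_option linter.dupNamespace false
set_option autoImplicit false

namespace Summit.HubbardSuperconductivity.HubbardSuperconductivity.Theorems.AnisotropyChord.FourTorus

/-! ## Generic loops and field access -/

/-- accumulator loop `iter n f a = f 0 (f 1 (… (f (n-1) a)))`. [folklore] -/
def iter {α : Type} (n : ℕ) (f : ℕ → α → α) (a : α) : α :=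
  Nat.rec (motive := fun _ => α → α) (fun x => x) (fun i ih x => ih (f i x)) n a

/-- `iter 0 f a = a`. [folklore] -/
theorem iter_zero {α : Type} (f : ℕ → α → α) (a : α) : iter 0 f a = a := rfl

/-- `iter (n+1) f a = iter n f (f n a)`. [folklore] -/
theorem iter_succ {α : Type} (n : ℕ) (f : ℕ → α → α) (a : α) : iter (n + 1) f a = iter n f (f n a) := rfl

/-- `∀ i < n, p i` as a Boolean loop. [folklore] -/
def allN (n : ℕ) (p : ℕ → Bool) : Bool := iter n (fun i ok => ok && p i) true

/-- `Σ_{i<n} g i` as a loop. [folklore] -/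
def sumN (n : ℕ) (g : ℕ → ℕ) : ℕ := iter n (fun i s => s + g i) 0

/-- field `i` of width `w` bits of a packed natural number. [folklore] -/
def field (w N i : ℕ) : ℕ := (N >>> (w * i)) % 2 ^ w

/-! ## Sites, symmetries, codes -/

/-- site `i < 16` ↦ vertex of `Q₄`. [folklore] -/
def cube (i : ℕ) : ℕ := field 4 Tab.cubeTab i
/-- vertex of `Q₄` ↦ site. [folklore] -/
def cubeInv (b : ℕ) : ℕ := field 4 Tab.cubeInvTab b
/-- `π_p(j)`. [folklore] -/
def perm4 (p j : ℕ) : ℕ := field 4 Tab.permTab (4 * p + j)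
/-- `π_p⁻¹(j)`. [folklore] -/
def permInv4 (p j : ℕ) : ℕ := field 4 Tab.permInvTab (4 * p + j)
/-- coordinate `j < 4` of a `Q₄` vertex (`j = 0` is the top bit). [folklore] -/
def bit4 (b j : ℕ) : ℕ := (b >>> (3 - j)) % 2
/-- coordinate permutation: new coordinate `j` = old coordinate `π_p(j)`. [folklore] -/
def permute4 (p b : ℕ) : ℕ :=
  bit4 b (perm4 p 0) * 8 + bit4 b (perm4 p 1) * 4 + bit4 b (perm4 p 2) * 2 + bit4 b (perm4 p 3)
/-- inverse coordinate permutation. [folklore] -/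
def permuteInv4 (p b : ℕ) : ℕ :=
  bit4 b (permInv4 p 0) * 8 + bit4 b (permInv4 p 1) * 4 + bit4 b (permInv4 p 2) * 2 + bit4 b (permInv4 p 3)
/-- the site map of the symmetry `(p, m)`. [folklore] -/
def siteMap (p m i : ℕ) : ℕ := cubeInv ((permute4 p (cube i)) ^^^ m)
/-- its inverse. [folklore] -/
def siteInv (p m j : ℕ) : ℕ := cubeInv (permuteInv4 p ((cube j) ^^^ m))
/-- adjacency of site indices (table). [folklore] -/
def adj16 (i j : ℕ) : Bool := field 1 Tab.adjTab (16 * i + j) == 1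
/-- move the low 16 bits of `k` along `siteMap p m`. [folklore] -/
def moveBits (p m k : ℕ) : ℕ :=
  iter 16 (fun i acc => bif Nat.testBit k i then acc ||| (1 <<< siteMap p m i) else acc) 0
/-- the action of `t = 32p + 2m + f` on codes. [folklore] -/
def actCode (t k : ℕ) : ℕ :=
  bif t % 2 == 1 then (moveBits (t / 32) ((t / 2) % 16) k) ^^^ 65535 else moveBits (t / 32) ((t / 2) % 16) k
/-- number of set bits among the low 16 (nibble table). [folklore] -/
def pop16 (k : ℕ) : ℕ :=
  field 4 Tab.popTab (k % 16) + field 4 Tab.popTab ((k >>> 4) % 16) + field 4 Tab.popTab ((k >>> 8) % 16) + field 4 Tab.popTab ((k >>> 12) % 16)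
/-- number of set bits among the low 16 (plain loop; the specification of `pop16`). [folklore] -/
def bitCount (k : ℕ) : ℕ := sumN 16 (fun i => bif Nat.testBit k i then 1 else 0)
/-- `C(p, m)` for `p, m < 16`. [folklore] -/
def binom (p m : ℕ) : ℕ := field 16 Tab.binomTab (16 * p + m)
/-- colexicographic rank of `k` among the codes of its own weight: `Σ_{p ∈ k} C(p, #(k ∩ [0,p)) + 1)`. [folklore] -/
def rank (k : ℕ) : ℕ :=
  iter 16 (fun p r => bif Nat.testBit k p then r + binom p (pop16 (k % 2 ^ p) + 1) else r) 0
/-- class of a weight-8 code (`63` off the sector). [folklore] -/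
def cls (k : ℕ) : ℕ := field 6 (clsChunk (k / 1024)) (k % 1024)
/-- weight-8 class representative. [folklore] -/
def rep8 (r : ℕ) : ℕ := field 16 Tab.rep8Tab r
/-- weight-9 class representative. [folklore] -/
def rep9 (r : ℕ) : ℕ := field 16 Tab.rep9Tab r
/-- symmetry witness of a weight-8 code. [folklore] -/
def wit8 (k : ℕ) : ℕ := field 10 (Tab.wit8Chunk (rank k / 2048)) (rank k % 2048)
/-- class of a weight-9 code. [folklore] -/
def cls9 (k : ℕ) : ℕ := (field 16 (Tab.wit9Chunk (rank k / 2048)) (rank k % 2048)) % 64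
/-- symmetry witness of a weight-9 code (even: a graph automorphism, no flip). [folklore] -/
def wit9 (k : ℕ) : ℕ := (field 16 (Tab.wit9Chunk (rank k / 2048)) (rank k % 2048)) / 64

/-! ## Kernel facts: bit count, site permutations -/

/-- `pop16` is the bit count, for all `k < 2^16`. [folklore] -/
theorem pop16_spec : allN 256 (fun c => allN 256 fun j => pop16 (256 * c + j) == bitCount (256 * c + j)) = true := by
  decide +kernel

/-- for all `p < 24`, `m < 16`: `siteMap p m` and `siteInv p m` are mutually inverse maps of `[0,16)` preserving `adj16`. [folklore] -/
theorem siteMap_spec :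
    allN 24 (fun p => allN 16 fun m => allN 16 fun i =>
      decide (siteMap p m i < 16) && decide (siteInv p m i < 16) && (siteInv p m (siteMap p m i) == i) &&
      (siteMap p m (siteInv p m i) == i) &&
      allN 16 fun j => adj16 (siteMap p m i) (siteMap p m j) == adj16 i j) = true := by
  decide +kernel

/-! ## Kernel passes over all codes `k < 2^16` (nested loops, bounded term depth) -/

/-- `∀ k ∈ [2^15 h, 2^15 (h+1)), p k` as a nested Boolean loop. [folklore] -/
def allHalf (h : ℕ) (p : ℕ → Bool) : Bool := allN 128 fun c => allN 256 fun j => p (256 * (128 * h + c) + j)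
/-- `Σ_{k < 2^16} g k` as a nested loop. [folklore] -/
def sum16 (g : ℕ → ℕ) : ℕ := sumN 256 fun c => sumN 256 fun j => g (256 * c + j)

/-- representatives are weight-8 codes of their own class. [folklore] -/
theorem rep8_spec : allN 58 (fun r => (pop16 (rep8 r) == 8) && (cls (rep8 r) == r) && decide (rep8 r < 65536)) = true := by
  decide +kernel

end Summit.HubbardSuperconductivity.HubbardSuperconductivity.Theorems.AnisotropyChord.FourTorus
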